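import Literature.Algebra.EuclideanLattices.MRIncGDDIdealised
import Literature.Algebra.EuclideanLattices.MRGapCVPWitnessPMF
import HarnessLib

/-!
# MR07 Thm. 5.23, eqs. (16)–(18) for the conditional law of one `W`-run given the conditions `(C, A, z)` — proved

Topic `Algebra/EuclideanLattices` (family `pqc`). Theorems only. In the idealised run of the procedure
`W` of Micciancio–Regev 2007, Thm. 5.23 (the experiment of `MRIncGDDIdealised.lean` with zero shifts,
`MRGapCVPRun.lean`), conditioned on the first stage `(c̄, h)` and the oracle's `(A, z)`, the lattice
vectors `y` have the product law `condLaw … 0 c̄ = ⨂ᵢ D_{Λ,s,ĉᵢ}` and the witness is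
`w = x − ∑ᵢ zᵢyᵢ = e − ∑ᵢ zᵢ(yᵢ − ĉᵢ)` with `e = x − ∑ᵢ zᵢĉᵢ` (`x = combineOutput`). This file transports
the per-sample bounds of `MRGapCVPWitnessPMF.lean` to exactly this conditional law and witness:

* `MicciancioRegev2007.sub_sum_smul_eq` — the identity `x − ∑ zᵢyᵢ = (x − ∑ zᵢĉᵢ) − ∑ zᵢ(yᵢ − ĉᵢ)`;
  `condLaw_zero` — `condLaw … 0 c̄ = ⨂ᵢ D_{Λ,s,ĉᵢ}`;
* `toReal_condLaw_le_norm_output_le` — eq. (17): `Pr[√(nm)·2sβ ≤ ‖w‖ | c̄, h, z] ≤ m(1+ε)/(1−ε)2⁻ⁿ`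
  when `‖x − ∑ zᵢĉᵢ‖ < sβ`, `∑ zᵢ² ≤ β²`;
* `integral_condLaw_inner_output_sq_le` — eq. (18): `E[⟨u, w⟩² | c̄, h, z] ≤ (2sβ)²`;
* `integral_condLaw_cos_output_le` — eq. (16) on the dual lattice: `E[cos(2π⟨t, w⟩) | c̄, h, z] ≤ 2·2⁻ⁿ`
  when `zⱼ ≠ 0`, `dist(−zⱼt, L) > g`, `s = 2√n/g`, `0 < g < λ₁(L)`.

## References

* D. Micciancio, O. Regev, *Worst-case to average-case reductions based on Gaussian measures*,
  SIAM J. Comput. 37 (2007) 267–302; authors' version, proof of Thm. 5.23, eqs. (16)–(18), pp. 30–31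
  ("conditioning on `C`, `A`, `z` …").
-/

noncomputable section

open MeasureTheory ProbabilityTheory Module Metric Finset Submodule
open scoped Real InnerProductSpace ENNReal Classical

namespace Literature.Algebra.EuclideanLattices

namespace MicciancioRegev2007

open Literature.Probability.Distributions

variable {V : Type*} [NormedAddCommGroup V] [InnerProductSpace ℝ V] [FiniteDimensional ℝ V]
  [MeasurableSpace V] [BorelSpace V]
variable {n : ℕ} (b : Basis (Fin n) ℝ V) (q d : ℕ)
variable (Λ : Submodule ℤ V) [DiscreteTopology Λ] [IsZLattice ℝ Λ]
variable (rep : (Fin n → ZMod (q * d)) ⧸ gridImage b (q * d) Λ → span ℤ (Set.range b))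
variable {m : ℕ}

omit [InnerProductSpace ℝ V] [FiniteDimensional ℝ V] [MeasurableSpace V] [BorelSpace V] in
/-- `x − ∑ zᵢyᵢ = (x − ∑ zᵢcᵢ) − ∑ zᵢ(yᵢ − cᵢ)` (p. 31: "`⟨u, w⟩ = ⟨u, x − Cz⟩ − ⟨u, (Y − C)z⟩`").
[cite: MicciancioRegev2007, Thm. 5.23 (proof, p. 31)] -/
theorem sub_sum_smul_eq [NormedSpace ℝ V] (x : V) (c y : Fin m → V) (z : Fin m → ℤ) :
    x - ∑ i, (z i : ℝ) • y i = (x - ∑ i, (z i : ℝ) • c i) - ∑ i, (z i : ℝ) • (y i - c i) := by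
  simp only [smul_sub, Finset.sum_sub_distrib]
  abel

omit [MeasurableSpace V] [BorelSpace V] [IsZLattice ℝ Λ] in
/-- With zero shifts the conditional law is `⨂ᵢ D_{Λ,s,ĉᵢ}`. [folklore] -/
theorem condLaw_zero (s : ℝ) (cbar : Fin m → (Fin n → ZMod (q * d)) ⧸ gridImage b (q * d) Λ) :
    condLaw b q d Λ rep s (fun _ => (0 : V)) cbar =
      indepLaw m fun i => discreteGaussian Λ s ((rep (cbar i) : V)) := by
  simp only [condLaw, zero_add]

/-- **MR07 eq. (17) for the conditional law of a `W`-run** (`0 < ε < 1`, `0 < s`, `η_ε(Λ) ≤ s`,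
`∑ zᵢ² ≤ β²`, `nm ≥ 1`, and `‖x − ∑ zᵢĉᵢ‖ < sβ` — Lemma 5.8 (iii) with eq. (15)):
`Pr[√(nm)·(2sβ) ≤ ‖x − ∑ zᵢyᵢ‖] ≤ m(1+ε)/(1−ε)2⁻ⁿ`. [cite: MicciancioRegev2007, Thm. 5.23 (proof, p. 31, eq. (17))] -/
theorem toReal_condLaw_le_norm_output_le {ε s β : ℝ} (hε : 0 < ε) (hε1 : ε < 1) (hs : 0 < s)
    (hηs : smoothingParameter Λ ε ≤ s) (cbar : Fin m → (Fin n → ZMod (q * d)) ⧸ gridImage b (q * d) Λ)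
    (x : V) {z : Fin m → ℤ} (hz : ∑ i, (z i : ℝ) ^ 2 ≤ β ^ 2) (hnm : 1 ≤ finrank ℝ V * m)
    (hx : ‖x - ∑ i, (z i : ℝ) • (rep (cbar i) : V)‖ < s * β) :
    ((condLaw b q d Λ rep s (fun _ => (0 : V)) cbar).toOuterMeasure
        {y | Real.sqrt (finrank ℝ V * m) * (2 * s * β) ≤
          ‖x - ∑ i, (z i : ℝ) • ((y i : Λ) : V)‖}).toReal ≤
      m * ((1 + ε) / (1 - ε) * (2⁻¹ : ℝ) ^ finrank ℝ V) := by
  rw [condLaw_zero]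
  have h := toReal_indepLaw_le_norm_witness_le Λ hε hε1 hs hηs (fun i => (rep (cbar i) : V)) hx hz hnm
  have hset : {y : Fin m → Λ | Real.sqrt (finrank ℝ V * m) * (2 * s * β) ≤
        ‖x - ∑ i, (z i : ℝ) • ((y i : Λ) : V)‖} =
      {y | Real.sqrt (finrank ℝ V * m) * (2 * s * β) ≤
        ‖(x - ∑ i, (z i : ℝ) • (rep (cbar i) : V)) -
          ∑ i, (z i : ℝ) • (((y i : Λ) : V) - (rep (cbar i) : V))‖} := by
    ext y
    rw [Set.mem_setOf_eq, Set.mem_setOf_eq, sub_sum_smul_eq x (fun i => (rep (cbar i) : V))]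
  rw [hset]
  exact h

/-- **MR07 eq. (18) for the conditional law of a `W`-run** (`2η_ε(Λ) ≤ s`, `‖x − ∑ zᵢĉᵢ‖ ≤ sβ`,
`∑ zᵢ² ≤ β²`, side condition `≤ 1`, unit `u`): `E⟨u, x − ∑ zᵢyᵢ⟩² ≤ (2sβ)²`.
[cite: MicciancioRegev2007, Thm. 5.23 (proof, p. 31, eqs. (18)–(20))] -/
theorem integral_condLaw_inner_output_sq_le {ε s β : ℝ} (hε : 0 < ε) (hε1 : ε < 1) (hs : 0 < s)
    (hηs : 2 * smoothingParameter Λ ε ≤ s) (cbar : Fin m → (Fin n → ZMod (q * d)) ⧸ gridImage b (q * d) Λ)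
    (x : V) {z : Fin m → ℤ} (hz : ∑ i, (z i : ℝ) ^ 2 ≤ β ^ 2)
    (hnum : 1 / (2 * π) + ε / (1 - ε) + (ε / (1 - ε)) ^ 2 * m ≤ 1) {u : V} (hu : ‖u‖ = 1)
    (hx : ‖x - ∑ i, (z i : ℝ) • (rep (cbar i) : V)‖ ≤ s * β) :
    ∫ y, ⟪u, x - ∑ i, (z i : ℝ) • ((y i : Λ) : V)⟫_ℝ ^ 2
        ∂(condLaw b q d Λ rep s (fun _ => (0 : V)) cbar).toMeasure ≤ (2 * s * β) ^ 2 := by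
  rw [condLaw_zero]
  have h := integral_indepLaw_inner_witness_sq_le_sq Λ hε hε1 hs hηs (fun i => (rep (cbar i) : V)) hx hz
    hnum hu
  refine le_of_eq_of_le (integral_congr_ae (Filter.Eventually.of_forall fun y => ?_)) h
  simp only [sub_sum_smul_eq x (fun i => (rep (cbar i) : V)) (fun i => ((y i : Λ) : V))]

/-- **MR07 eq. (16) for the conditional law of a `W`-run on the dual lattice**: `L` full-rank,
`n ≥ 2`, `0 < g < λ₁(L)`, `s = 2√n/g`, `zⱼ ≠ 0` with `dist(−zⱼt, L) > g`:
`E cos(2π⟨t, x − ∑ zᵢyᵢ⟩) ≤ 2·2⁻ⁿ` for `y ∼ ⨂ᵢ D_{L*,s,ĉᵢ}`.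
[cite: MicciancioRegev2007, Thm. 5.23 (proof, p. 30, eq. (16))] -/
theorem integral_condLaw_cos_output_le (L : Submodule ℤ V) [DiscreteTopology L] [IsZLattice ℝ L]
    (repD : (Fin n → ZMod (q * d)) ⧸ gridImage b (q * d) (dualLattice L) → span ℤ (Set.range b))
    (hn : 2 ≤ finrank ℝ V) {g : ℝ} (hg : 0 < g) (hgL : g < minNorm L)
    (cbar : Fin m → (Fin n → ZMod (q * d)) ⧸ gridImage b (q * d) (dualLattice L)) (x t : V)
    {z : Fin m → ℤ} {j : Fin m} (hzj : z j ≠ 0)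
    (hfar : g < infDist (((-z j : ℤ) : ℝ) • t) (L : Set V)) :
    ∫ y, Real.cos (2 * π * ⟪t, x - ∑ i, (z i : ℝ) • ((y i : dualLattice L) : V)⟫_ℝ)
        ∂(condLaw b q d (dualLattice L) repD (2 * Real.sqrt (finrank ℝ V) / g) (fun _ => (0 : V))
          cbar).toMeasure ≤ 2 * (2⁻¹ : ℝ) ^ finrank ℝ V := by
  rw [condLaw_zero]
  have h := integral_indepLaw_cos_witness_le (m := m) L hn hg hgL (fun i => (repD (cbar i) : V))
    (x - ∑ i, (z i : ℝ) • (repD (cbar i) : V)) t hzj hfar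
  refine le_of_eq_of_le (integral_congr_ae (Filter.Eventually.of_forall fun y => ?_)) h
  simp only [sub_sum_smul_eq x (fun i => (repD (cbar i) : V)) (fun i => ((y i : dualLattice L) : V))]

end MicciancioRegev2007

end Literature.Algebra.EuclideanLattices

end
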